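import Literature.Barriers.AtomisticToContinuum.DisorderedHarmonicChainExpMoments
import Literature.Barriers.AtomisticToContinuum.DisorderedHarmonicChainVariations
import Literature.Barriers.AtomisticToContinuum.DisorderedHarmonicChainIBP
import Literature.Barriers.AtomisticToContinuum.DisorderedHarmonicChainSweep
import Mathlib.Probability.Moments.SubGaussian
import Mathlib.Analysis.SpecialFunctions.Pow.Real
import HarnessLib

/-!
# Ajanki–Huveneers 2011: moments along the phase chain — tilts, the derivative cocycle, the good sum

Tools for the integration-by-parts route to the upper bound (5.1) of Prop. 5.1 of O. Ajanki,
F. Huveneers, CMP **301** (2011) 841–883, arXiv:1003.1076 (the paper proves (5.1) by a parametrix,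
Lemmas 5.2–5.5; Lemma 5.3 as printed is refuted in `…RyCounterexample.lean`, and this route does
not use it). Everything here is PROVED, on the disorder space `τ^{⊗n}`:

* `pi_ibp_cube`: the integration by parts along one reduced mass of `…IBP.lean` with the `C¹`
  hypotheses required only on the cube `[b₋, b₊]ⁿ` (which carries the measure);
* `lintegral_exp_sumT_le`, `integral_exp_sumT_le`: **first-step peeling for time-dependent
  summands** `∑_{l<n} h_l(X^y_l, B_l)` (Lemma 4.2 / App. 7.2: Freedman–Azuma by iterated
  conditioning), with the Hoeffding bound for linear majorants `h_l(y,b) ≤ a_l(y)b + K`;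
* `integral_tilt_mul_vaJ_rpow_le`: **joint exponential moments of the tilt
  `e^{pw∑h(X_l)B_l}` and of real powers `J_i^q` of the derivative cocycle** `J = ∏P⁻¹`
  (`= Γ⁻²` up to the first factor, Prop. 3.5 (3.19)–(3.21)): `≤ e^{C₀w²n}`, i.e. `𝒪(1)` for
  `w²n ≤ 1`, because `log P = -2δ sin 2πX + 𝒪(δ²)` is linear in the centred `B` at first order;
* `measure_vaN_lt_le`: **the good sum is large**: `ℙ(N_m < 2νm) ≤ e^{-cm}` for
  `N_m = ∑_{k<m} ξ(B_k)(1 - cos 2πX_k)`, `wm ≥ κ` (half of the steps have `sin²πX_k ≥ 4η²` by the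
  sweep count of `…Sweep.lean`, Cor. 3.4 (i); Hoeffding for the centred `ξ(B_k) - 𝔼ξ(B)`);
* integrability plumbing on the cube.

[cite: AjankiHuveneers2011, Lemma 4.2, App. 7.2, Prop. 3.5 eqs. (3.19)-(3.21), Cor. 3.4 (i), Prop. 5.1 eq. (5.1)]
-/

noncomputable section

open Real MeasureTheory ProbabilityTheory Set Filter Function Finset
open scoped ENNReal

namespace Literature.Barriers.AtomisticToContinuum.HeatConduction

variable {τ : ℝ → ℝ} {bm bp : ℝ}

/-! ### Integration by parts with hypotheses on the cube only -/

section IBPCube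

/-- **Integration by parts along one reduced mass, hypotheses on the cube.** As `pi_ibp`, but the
section `b ↦ Ψ(B[k ↦ b])` is only required to be `C¹` on `[b₋, b₊]` (derivative `D`, continuous)
for configurations `B` of the closed cube `[b₋, b₊]^{n+1}`, which has full measure. [folklore] -/
theorem pi_ibp_cube (hτ : ReducedLawHyp τ bm bp) (S : SmoothingField τ bm bp)
    {ρB : Measure ℝ} [IsProbabilityMeasure ρB]
    (hρ : ρB = volume.withDensity fun s => ENNReal.ofReal (τ s))
    {n : ℕ} (k : Fin (n + 1)) (a Ψ D : (Fin (n + 1) → ℝ) → ℝ)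
    (ha : ∀ B b, a (Function.update B k b) = a B)
    (hD : ∀ B : Fin (n + 1) → ℝ, (∀ i, bm ≤ B i ∧ B i ≤ bp) → ∀ b ∈ Set.Icc bm bp,
      HasDerivAt (fun b => Ψ (Function.update B k b)) (D (Function.update B k b)) b)
    (hDc : ∀ B : Fin (n + 1) → ℝ, (∀ i, bm ≤ B i ∧ B i ≤ bp) →
      ContinuousOn (fun b => D (Function.update B k b)) (Set.Icc bm bp))
    (hI1 : Integrable (fun B => a B * S.ξ (B k) * D B) (Measure.pi fun _ : Fin (n + 1) => ρB))
    (hI2 : Integrable (fun B => a B * S.ℓ (B k) * Ψ B) (Measure.pi fun _ : Fin (n + 1) => ρB)) :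
    ∫ B, a B * S.ξ (B k) * D B ∂(Measure.pi fun _ : Fin (n + 1) => ρB) =
      -∫ B, a B * S.ℓ (B k) * Ψ B ∂(Measure.pi fun _ : Fin (n + 1) => ρB) := by
  rw [integral_pi_update ρB k _ hI1, integral_pi_update ρB k _ hI2, ← integral_neg]
  refine integral_congr_ae ((ae_pi_mem_Icc hτ.eq_zero hρ (n + 1)).mono fun B hB => ?_)
  simp only [ha, Function.update_self]
  have e1 : ∫ b, a B * S.ξ b * D (Function.update B k b) ∂ρB =
      a B * ∫ b, S.ξ b * D (Function.update B k b) * τ b := by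
    rw [← integral_const_mul, integral_rhoB hτ hρ]
    refine integral_congr_ae (ae_of_all _ fun b => ?_)
    ring
  have e2 : ∫ b, a B * S.ℓ b * Ψ (Function.update B k b) ∂ρB =
      a B * ∫ b, S.ℓ b * Ψ (Function.update B k b) * τ b := by
    rw [← integral_const_mul, integral_rhoB hτ hρ]
    refine integral_congr_ae (ae_of_all _ fun b => ?_)
    ring
  rw [e1, e2, S.ibp (fun b => Ψ (Function.update B k b)) (fun b => D (Function.update B k b)) (hD B hB)
    (hDc B hB)]
  ring

end IBPCube

/-! ### First-step peeling for time-dependent summands -/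

section Peeling

/-- One-step decomposition of a time-dependent sum along the chain:
`∑_{l<n+1} h_l(X^y_l, B_l)(b :: B') = h_0(y,b) + ∑_{l<n} h_{l+1}(X^{f_b(y)}_l, B'_l)(B')`.
[cite: AjankiHuveneers2011, Def. 3.3 (Markov property)] -/
theorem sumT_cons (w : ℝ) (h : ℕ → ℝ → ℝ → ℝ) (y : ℝ) (n : ℕ) (b : ℝ) (B' : Fin n → ℝ) :
    ∑ l ∈ Finset.range (n + 1), h l (ahPhase w y (finExt (Fin.cons b B' : Fin (n + 1) → ℝ)) l)
        (finExt (Fin.cons b B' : Fin (n + 1) → ℝ) l) =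
      h 0 y b + ∑ l ∈ Finset.range n, h (l + 1) (ahPhase w (ahStep w b y) (finExt B') l) (finExt B' l) := by
  rw [Finset.sum_range_succ']
  simp only [ahPhase_finExt_cons, finExt_cons_zero, finExt_cons_succ, ahPhase_zero]
  ring

/-- Measurability of a time-dependent sum functional. [folklore] -/
theorem measurable_sumT (w : ℝ) {h : ℕ → ℝ → ℝ → ℝ} (hh : ∀ l, Measurable (Function.uncurry (h l)))
    (y : ℝ) (n : ℕ) :
    Measurable fun B : Fin n → ℝ =>
      ∑ l ∈ Finset.range n, h l (ahPhase w y (finExt B) l) (finExt B l) := by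
  refine Finset.measurable_sum _ fun l _ => ?_
  exact (hh l).comp ((measurable_ahPhase_pi w y l).prodMk (measurable_finExt l))

/-- **First-step peeling, time-dependent**: if `∫ e^{h_l(y,b)} ρ_B(db) ≤ θ_l` for every `l`, `y`,
then `∫ exp(∑_{l<n} h_l(X^y_l, B_l)) dρ_B^{⊗n} ≤ ∏_{l<n} θ_l` for every `n` and every start `y`.
[cite: AjankiHuveneers2011, Lemma 4.2 and App. 7.2 ("Iterating this finishes the proof")] -/
theorem lintegral_exp_sumT_le (w : ℝ) (ρB : Measure ℝ) [IsProbabilityMeasure ρB] :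
    ∀ (n : ℕ) (h : ℕ → ℝ → ℝ → ℝ) (θ : ℕ → ℝ≥0∞), (∀ l, Measurable (Function.uncurry (h l))) →
      (∀ l y, ∫⁻ b, ENNReal.ofReal (Real.exp (h l y b)) ∂ρB ≤ θ l) → ∀ y : ℝ,
      ∫⁻ B, ENNReal.ofReal (Real.exp (∑ l ∈ Finset.range n,
          h l (ahPhase w y (finExt B) l) (finExt B l))) ∂(Measure.pi fun _ : Fin n => ρB) ≤
        ∏ l ∈ Finset.range n, θ l := by
  intro n
  induction n with
  | zero =>
    intro h θ _ _ y
    simp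
  | succ n ih =>
    intro h θ hh hθ y
    set g : (Fin (n + 1) → ℝ) → ℝ≥0∞ := fun B => ENNReal.ofReal (Real.exp (∑ l ∈ Finset.range (n + 1),
      h l (ahPhase w y (finExt B) l) (finExt B l))) with hg
    have hgm : Measurable g :=
      ENNReal.measurable_ofReal.comp (Real.measurable_exp.comp (measurable_sumT w hh y (n + 1)))
    have hcons : ∀ (b : ℝ) (B' : Fin n → ℝ), g (Fin.cons b B') =
        ENNReal.ofReal (Real.exp (h 0 y b)) *
          ENNReal.ofReal (Real.exp (∑ l ∈ Finset.range n,
            h (l + 1) (ahPhase w (ahStep w b y) (finExt B') l) (finExt B' l))) := by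
      intro b B'
      rw [hg]
      dsimp only
      rw [sumT_cons, Real.exp_add, ENNReal.ofReal_mul (Real.exp_pos _).le]
    have ih' := ih (fun l => h (l + 1)) (fun l => θ (l + 1)) (fun l => hh (l + 1)) (fun l y => hθ (l + 1) y)
    show ∫⁻ B, g B ∂(Measure.pi fun _ : Fin (n + 1) => ρB) ≤ ∏ l ∈ Finset.range (n + 1), θ l
    rw [ig_lintegral_pi_succ ρB n hgm, Finset.prod_range_succ']
    calc ∫⁻ b, ∫⁻ B', g (Fin.cons b B') ∂(Measure.pi fun _ : Fin n => ρB) ∂ρB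
        = ∫⁻ b, ENNReal.ofReal (Real.exp (h 0 y b)) *
            ∫⁻ B', ENNReal.ofReal (Real.exp (∑ l ∈ Finset.range n,
              h (l + 1) (ahPhase w (ahStep w b y) (finExt B') l) (finExt B' l)))
              ∂(Measure.pi fun _ : Fin n => ρB) ∂ρB := by
          refine lintegral_congr fun b => ?_
          rw [← lintegral_const_mul' _ _ ENNReal.ofReal_ne_top]
          exact lintegral_congr fun B' => hcons b B'
      _ ≤ ∫⁻ b, ENNReal.ofReal (Real.exp (h 0 y b)) * ∏ l ∈ Finset.range n, θ (l + 1) ∂ρB :=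
          lintegral_mono fun b => mul_le_mul' le_rfl (ih' (ahStep w b y))
      _ = (∫⁻ b, ENNReal.ofReal (Real.exp (h 0 y b)) ∂ρB) * ∏ l ∈ Finset.range n, θ (l + 1) := by
          have hmb : Measurable fun b : ℝ => ENNReal.ofReal (Real.exp (h 0 y b)) :=
            ENNReal.measurable_ofReal.comp
              (Real.measurable_exp.comp ((hh 0).comp (measurable_const.prodMk measurable_id)))
          rw [lintegral_mul_const'' _ (f := fun b => ENNReal.ofReal (Real.exp (h 0 y b)))
            hmb.aemeasurable]
      _ ≤ θ 0 * ∏ l ∈ Finset.range n, θ (l + 1) := mul_le_mul' (hθ 0 y) le_rfl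
      _ = (∏ l ∈ Finset.range n, θ (l + 1)) * θ 0 := mul_comm _ _

/-- **Exponential moment of a time-dependent sum with predictable linear majorants**: if
`h_l(y,b) ≤ a_l(y) b + K` on `[b₋, b₊]` with `|a_l| ≤ A`, then `exp(∑_{l<n} h_l(X^y_l, B_l))` is
integrable and `∫ exp(∑_{l<n} h_l(X^y_l, B_l)) dρ_B^{⊗n} ≤ e^{n(K + s²A²/2)}`, `s = (b₊-b₋)/2`.
[cite: AjankiHuveneers2011, Lemma 4.2 eq. (4.4)] -/
theorem integral_exp_sumT_le (hτ : ReducedLawHyp τ bm bp) {ρB : Measure ℝ}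
    [IsProbabilityMeasure ρB] (hρ : ρB = volume.withDensity fun s => ENNReal.ofReal (τ s))
    (w : ℝ) {h : ℕ → ℝ → ℝ → ℝ} (hh : ∀ l, Measurable (Function.uncurry (h l)))
    {a : ℕ → ℝ → ℝ} {A K : ℝ}
    (hA : ∀ l y, |a l y| ≤ A) (hmaj : ∀ l y, ∀ b ∈ Set.Icc bm bp, h l y b ≤ a l y * b + K)
    (n : ℕ) (y : ℝ) :
    Integrable (fun B : Fin n → ℝ => Real.exp (∑ l ∈ Finset.range n,
        h l (ahPhase w y (finExt B) l) (finExt B l))) (Measure.pi fun _ : Fin n => ρB) ∧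
      ∫ B, Real.exp (∑ l ∈ Finset.range n, h l (ahPhase w y (finExt B) l) (finExt B l))
          ∂(Measure.pi fun _ : Fin n => ρB) ≤
        Real.exp (n * (K + ((bp - bm) / 2) ^ 2 * A ^ 2 / 2)) := by
  have hbd : ∫⁻ B, ENNReal.ofReal (Real.exp (∑ l ∈ Finset.range n,
      h l (ahPhase w y (finExt B) l) (finExt B l))) ∂(Measure.pi fun _ : Fin n => ρB) ≤
      ENNReal.ofReal (Real.exp (n * (K + ((bp - bm) / 2) ^ 2 * A ^ 2 / 2))) := by
    have h1 := lintegral_exp_sumT_le w ρB n h (fun _ => ENNReal.ofReal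
      (Real.exp (K + ((bp - bm) / 2) ^ 2 * A ^ 2 / 2))) hh
      (fun l y' => lintegral_exp_le_of_linear_bound hτ hρ (h := h l) (a := a l) (hA l) (hmaj l) y') y
    refine h1.trans (le_of_eq ?_)
    rw [Finset.prod_const, Finset.card_range, ← ENNReal.ofReal_pow (Real.exp_pos _).le,
      ← Real.exp_nat_mul]
  set F : (Fin n → ℝ) → ℝ := fun B => Real.exp (∑ l ∈ Finset.range n,
    h l (ahPhase w y (finExt B) l) (finExt B l)) with hF
  have hmeas : AEStronglyMeasurable F (Measure.pi fun _ : Fin n => ρB) :=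
    (Real.measurable_exp.comp (measurable_sumT w hh y n)).aestronglyMeasurable
  have hfin : HasFiniteIntegral F (Measure.pi fun _ : Fin n => ρB) := by
    rw [hasFiniteIntegral_iff_ofReal (ae_of_all _ fun B => (Real.exp_pos _).le)]
    exact lt_of_le_of_lt hbd ENNReal.ofReal_lt_top
  have hint : Integrable F (Measure.pi fun _ : Fin n => ρB) := ⟨hmeas, hfin⟩
  refine ⟨hint, ?_⟩
  exact (ENNReal.ofReal_le_ofReal_iff (Real.exp_pos _).le).mp
    (by rwa [ofReal_integral_eq_lintegral_ofReal hint (ae_of_all _ fun B => (Real.exp_pos _).le)])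

end Peeling

/-! ### Joint exponential moments of the tilt and of powers of the derivative cocycle -/

section TiltCocycle

/-- `(x, δ) ↦ P(x, δ)` is continuous. [folklore] -/
theorem continuous_pcP_uncurry : Continuous fun p : ℝ × ℝ => pcP p.1 p.2 := by
  unfold pcP; fun_prop

/-- **Real powers of the cocycle are exponentials of a sum along the chain**:
`J_i^q = exp(∑_{l<i} -q log P_l)`. [cite: AjankiHuveneers2011, Prop. 3.5 eq. (3.19)] -/
theorem vaJ_rpow_eq_exp (w x : ℝ) (B : ℕ → ℝ) (i : ℕ) (q : ℝ) :
    vaJ w x B i ^ q = Real.exp (∑ l ∈ Finset.range i, -q * Real.log (vaP w x B l)) := by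
  have hpos : ∀ l, 0 < vaP w x B l := vaP_pos w x B
  rw [Real.rpow_def_of_pos (vaJ_pos w x B i)]
  congr 1
  unfold vaJ
  rw [Real.log_prod (s := Finset.range i) (f := fun l => (vaP w x B l)⁻¹) (fun l _ => (inv_pos.mpr (hpos l)).ne'), Finset.sum_mul]
  refine Finset.sum_congr rfl fun l _ => ?_
  rw [Real.log_inv]; ring

/-- The linear majorant of `-q log P(y, δ(w,b))` in the small regime:
`-q log P ≤ (2q c(w) sin 2πy) b + 22|q| δ²` (`|δ| ≤ 1/8`). [cite: AjankiHuveneers2011, Prop. 3.5 eqs. (3.19)-(3.21)] -/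
theorem neg_mul_log_pcP_le {w b : ℝ} (hδ : |igDelta w b| ≤ 1 / 8) (q y : ℝ) :
    -q * Real.log (pcP y (igDelta w b)) ≤
      (2 * q * igC w * Real.sin (2 * π * y)) * b + 22 * |q| * (igDelta w b) ^ 2 := by
  have h := abs_log_pcP_add_le hδ y
  set r := Real.log (pcP y (igDelta w b)) + 2 * igDelta w b * Real.sin (2 * π * y) with hr
  have hlog : Real.log (pcP y (igDelta w b)) = r - 2 * igDelta w b * Real.sin (2 * π * y) := by
    rw [hr]; ring
  rw [hlog]
  have hqr : -q * r ≤ |q| * (22 * igDelta w b ^ 2) := by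
    calc -q * r ≤ |-q * r| := le_abs_self _
      _ = |q| * |r| := by rw [abs_mul, abs_neg]
      _ ≤ |q| * (22 * igDelta w b ^ 2) := mul_le_mul_of_nonneg_left h (abs_nonneg q)
  have he : -q * (r - 2 * igDelta w b * Real.sin (2 * π * y)) =
      -q * r + (2 * q * igC w * Real.sin (2 * π * y)) * b := by
    unfold igDelta; ring
  rw [he]
  linarith

/-- **Joint exponential moments of the tilt and of the cocycle.** For a bounded measurable `h`
and real `p`, `q` there is `C₀` (depending on `p`, `q`, `sup|h|` and the law) such that for
`0 < w ≤ w_pc(b_*)`, all `i ≤ n`, every start `x`: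
`𝔼[e^{pw∑_{l<n} h(X_l)B_l} J_i^q] ≤ e^{C₀w²n}` (with integrability). In particular these moments
are `𝒪(1)` for `w²n ≤ 1`. [cite: AjankiHuveneers2011, Lemma 4.2 eq. (4.4), Prop. 3.5 eqs. (3.19)-(3.21)] -/
theorem integral_tilt_mul_vaJ_rpow_le (hτ : ReducedLawHyp τ bm bp) {ρB : Measure ℝ}
    [IsProbabilityMeasure ρB] (hρ : ρB = volume.withDensity fun s => ENNReal.ofReal (τ s))
    {h : ℝ → ℝ} (hhm : Measurable h) {H : ℝ} (hH : ∀ y, |h y| ≤ H) (p q : ℝ) :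
    ∃ C₀ : ℝ, 0 ≤ C₀ ∧ ∀ w ∈ Set.Ioc 0 (pcW (max |bm| |bp|)), ∀ (n i : ℕ), i ≤ n → ∀ x : ℝ,
      Integrable (fun b : Fin n → ℝ =>
          Real.exp (p * (w * ∑ l ∈ Finset.range n, h (ahPhase w x (finExt b) l) * finExt b l)) *
            vaJ w x (finExt b) i ^ q) (Measure.pi fun _ : Fin n => ρB) ∧
      ∫ b, Real.exp (p * (w * ∑ l ∈ Finset.range n, h (ahPhase w x (finExt b) l) * finExt b l)) *
            vaJ w x (finExt b) i ^ q ∂(Measure.pi fun _ : Fin n => ρB) ≤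
        Real.exp (C₀ * w ^ 2 * n) := by
  set bstar : ℝ := max |bm| |bp| with hbstar
  have hbstar0 : 0 ≤ bstar := le_max_of_le_left (abs_nonneg _)
  have hH0 : 0 ≤ H := (abs_nonneg _).trans (hH 0)
  set s2 : ℝ := ((bp - bm) / 2) ^ 2 with hs2
  set C₀ : ℝ := 22 * |q| * π ^ 2 * bstar ^ 2 + s2 * (|p| * H + 2 * π * |q|) ^ 2 / 2 with hC₀
  refine ⟨C₀, by positivity, ?_⟩
  intro w hw n i hin x
  obtain ⟨hw0, hwle⟩ := hw
  obtain ⟨hw2, -, -⟩ := pc_small hbstar0 hw0.le hwle (show |(0:ℝ)| ≤ bstar by rw [abs_zero]; exact hbstar0)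
  have hwπ : π * w / 2 < 1 := by linarith
  have hc_hi : igC w ≤ π * w := igC_le hw0.le hw2
  have hc_lo : 0 ≤ igC w := le_trans (by positivity) (le_igC hw0.le hwπ)
  -- the time-dependent summands
  set hl : ℕ → ℝ → ℝ → ℝ := fun l y b =>
    p * w * h y * b + (if l < i then -q * Real.log (pcP y (igDelta w b)) else 0) with hhl
  set al : ℕ → ℝ → ℝ := fun l y =>
    p * w * h y + (if l < i then 2 * q * igC w * Real.sin (2 * π * y) else 0) with hal
  set A : ℝ := w * (|p| * H + 2 * π * |q|) with hA
  set K : ℝ := 22 * |q| * π ^ 2 * bstar ^ 2 * w ^ 2 with hK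
  have hhm : ∀ l, Measurable (Function.uncurry (hl l)) := by
    intro l
    have h1 : Measurable fun z : ℝ × ℝ => p * w * h z.1 * z.2 :=
      ((measurable_const.mul (hhm.comp measurable_fst)).mul measurable_snd)
    have h2 : Measurable fun z : ℝ × ℝ => -q * Real.log (pcP z.1 (igDelta w z.2)) := by
      refine measurable_const.mul (Real.measurable_log.comp ?_)
      have : Continuous fun z : ℝ × ℝ => pcP z.1 (igDelta w z.2) := by
        unfold igDelta
        exact continuous_pcP_uncurry.comp (continuous_fst.prodMk (continuous_const.mul continuous_snd))
      exact this.measurable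
    by_cases hli : l < i
    · simp only [hhl, hli, ↓reduceIte]
      exact h1.add h2
    · simp only [hhl, hli, ↓reduceIte, add_zero]
      exact h1
  have hAl : ∀ l y, |al l y| ≤ A := by
    intro l y
    have h1 : |p * w * h y| ≤ w * (|p| * H) := by
      rw [abs_mul, abs_mul, abs_of_pos hw0]
      nlinarith [hH y, abs_nonneg p, abs_nonneg (h y), mul_nonneg (abs_nonneg p) hw0.le]
    have h2 : |2 * q * igC w * Real.sin (2 * π * y)| ≤ w * (2 * π * |q|) := by
      rw [abs_mul, abs_mul, abs_mul, abs_two, abs_of_nonneg hc_lo]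
      have hs := Real.abs_sin_le_one (2 * π * y)
      calc 2 * |q| * igC w * |Real.sin (2 * π * y)| ≤ 2 * |q| * (π * w) * 1 := by
            gcongr
        _ = w * (2 * π * |q|) := by ring
    by_cases hli : l < i
    · simp only [hal, hli, ↓reduceIte]
      calc |p * w * h y + 2 * q * igC w * Real.sin (2 * π * y)|
          ≤ |p * w * h y| + |2 * q * igC w * Real.sin (2 * π * y)| := abs_add_le _ _
        _ ≤ w * (|p| * H) + w * (2 * π * |q|) := add_le_add h1 h2
        _ = A := by rw [hA]; ring
    · simp only [hal, hli, ↓reduceIte, add_zero]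
      calc |p * w * h y| ≤ w * (|p| * H) := h1
        _ ≤ A := by rw [hA]; nlinarith [abs_nonneg q, Real.pi_pos]
  have hmaj : ∀ l y, ∀ b ∈ Set.Icc bm bp, hl l y b ≤ al l y * b + K := by
    intro l y b hb
    have hbabs : |b| ≤ bstar := ReducedLawHyp.abs_le_of_mem hb
    obtain ⟨-, -, hδ⟩ := pc_small hbstar0 hw0.le hwle hbabs
    have hδ2 : igDelta w b ^ 2 ≤ π ^ 2 * bstar ^ 2 * w ^ 2 := by
      have h1 : |igDelta w b| ≤ π * w * bstar :=
        (abs_igDelta_le hw0.le hw2 b).trans (mul_le_mul_of_nonneg_left hbabs (by positivity))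
      calc igDelta w b ^ 2 = |igDelta w b| ^ 2 := (sq_abs _).symm
        _ ≤ (π * w * bstar) ^ 2 := pow_le_pow_left₀ (abs_nonneg _) h1 2
        _ = π ^ 2 * bstar ^ 2 * w ^ 2 := by ring
    have hK' : 22 * |q| * igDelta w b ^ 2 ≤ K := by
      rw [hK]
      calc 22 * |q| * igDelta w b ^ 2 ≤ 22 * |q| * (π ^ 2 * bstar ^ 2 * w ^ 2) :=
            mul_le_mul_of_nonneg_left hδ2 (by positivity)
        _ = _ := by ring
    by_cases hli : l < i
    · simp only [hhl, hal, hli, ↓reduceIte]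
      have := neg_mul_log_pcP_le hδ q y
      nlinarith
    · simp only [hhl, hal, hli, ↓reduceIte, add_zero]
      have : 0 ≤ K := by rw [hK]; positivity
      nlinarith
  -- the integrand is the exponential of the sum
  have hrepr : ∀ b : Fin n → ℝ,
      Real.exp (p * (w * ∑ l ∈ Finset.range n, h (ahPhase w x (finExt b) l) * finExt b l)) *
          vaJ w x (finExt b) i ^ q =
        Real.exp (∑ l ∈ Finset.range n, hl l (ahPhase w x (finExt b) l) (finExt b l)) := by
    intro b
    rw [vaJ_rpow_eq_exp, ← Real.exp_add]
    congr 1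
    simp only [hhl, Finset.sum_add_distrib]
    congr 1
    · rw [Finset.mul_sum, Finset.mul_sum]
      exact Finset.sum_congr rfl fun l _ => by ring
    · rw [← Finset.sum_filter]
      have hf : (Finset.range n).filter (fun l => l < i) = Finset.range i := by
        ext l; simp only [Finset.mem_filter, Finset.mem_range]; omega
      rw [hf]
      rfl
  obtain ⟨hint, hbound⟩ := integral_exp_sumT_le hτ hρ w hhm hAl hmaj n x
  have hfun : (fun b : Fin n → ℝ =>
      Real.exp (p * (w * ∑ l ∈ Finset.range n, h (ahPhase w x (finExt b) l) * finExt b l)) *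
        vaJ w x (finExt b) i ^ q) =
      fun b => Real.exp (∑ l ∈ Finset.range n, hl l (ahPhase w x (finExt b) l) (finExt b l)) :=
    funext hrepr
  rw [hfun]
  refine ⟨hint, hbound.trans (Real.exp_le_exp.mpr (le_of_eq ?_))⟩
  rw [hK, hA, hC₀]
  ring

end TiltCocycle

/-! ### The good sum is large outside an exponentially small event -/

section GoodSum

/-- `𝔼 ξ(B)`-centred bump is subgaussian with the Hoeffding constant of width `1`:
`∫ e^{t(ξ(b) - p̃)} ρ_B(db) ≤ e^{t²/8}`, `p̃ = ∫ ξ τ`. [folklore] -/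
theorem lintegral_exp_mul_centredBump_le (hτ : ReducedLawHyp τ bm bp) (S : SmoothingField τ bm bp)
    {ρB : Measure ℝ} [IsProbabilityMeasure ρB]
    (hρ : ρB = volume.withDensity fun s => ENNReal.ofReal (τ s)) (t : ℝ) :
    ∫⁻ b, ENNReal.ofReal (Real.exp (t * (S.ξ b - ∫ b', S.ξ b' * τ b'))) ∂ρB ≤
      ENNReal.ofReal (Real.exp (t ^ 2 / 8)) := by
  set pt : ℝ := ∫ b', S.ξ b' * τ b' with hpt
  have hξi : Integrable S.ξ ρB := by
    refine (integrable_const (1 : ℝ)).mono' S.ξ_measurable.aestronglyMeasurable (ae_of_all _ fun b => ?_)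
    rw [Real.norm_eq_abs, abs_of_nonneg (S.ξ_nonneg b)]
    exact S.ξ_le_one b
  have hmean : ∫ b, (S.ξ b - pt) ∂ρB = 0 := by
    rw [integral_sub hξi (integrable_const _), integral_const, probReal_univ, one_smul,
      integral_rhoB hτ hρ, hpt, sub_self]
  have hmem : ∀ᵐ b ∂ρB, S.ξ b - pt ∈ Set.Icc (-pt) (1 - pt) :=
    ae_of_all _ fun b => ⟨by linarith [S.ξ_nonneg b], by linarith [S.ξ_le_one b]⟩
  have hsg := hasSubgaussianMGF_of_mem_Icc_of_integral_eq_zero (X := fun b : ℝ => S.ξ b - pt) (μ := ρB)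
    (S.ξ_measurable.sub measurable_const).aemeasurable hmem hmean
  have hint := hsg.integrable_exp_mul t
  have h := hsg.mgf_le t
  simp only [mgf] at h
  have hs : ((‖(1 - pt) - -pt‖₊ / 2 : NNReal) : ℝ) = 1 / 2 := by
    rw [NNReal.coe_div, coe_nnnorm, show (1 - pt) - -pt = 1 by ring, Real.norm_eq_abs, abs_one]
    norm_num
  have h' : ∫ b, Real.exp (t * (S.ξ b - pt)) ∂ρB ≤ Real.exp (t ^ 2 / 8) := by
    refine h.trans (le_of_eq ?_)
    rw [NNReal.coe_pow, hs]
    ring_nf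
  rw [← ofReal_integral_eq_lintegral_ofReal hint (ae_of_all _ fun b => (Real.exp_pos _).le)]
  exact ENNReal.ofReal_le_ofReal h'

/-- **The good sum is large.** For the bump `ξ` of a smoothing field (`p̃ = ∫ ξ τ > 0`) and
`κ > 0` there are `w₀, ν, c > 0` such that for `0 < w ≤ w₀`, every `j ≤ n` with `wj ≥ κ` and
every start `x`: `ℙ(N_j < 2νj) ≤ e^{-cj}`, `N_j = ∑_{k<j} ξ(B_k)(1 - cos 2πX_k)`
("half of the steps have `sin²πX_k ≥ 4η²`", and Hoeffding–Azuma for `∑ (ξ(B_k) - p̃)u_k`).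
[cite: AjankiHuveneers2011, Cor. 3.4 (i) and Lemma 4.2 eq. (4.4)] -/
theorem measure_vaN_lt_le (hτ : ReducedLawHyp τ bm bp) (S : SmoothingField τ bm bp)
    {ρB : Measure ℝ} [IsProbabilityMeasure ρB]
    (hρ : ρB = volume.withDensity fun s => ENNReal.ofReal (τ s)) {κ : ℝ} (hκ : 0 < κ) :
    ∃ w₀ : ℝ, 0 < w₀ ∧ ∃ ν : ℝ, 0 < ν ∧ ∃ c : ℝ, 0 < c ∧ ∀ w ∈ Set.Ioc 0 w₀,
      ∀ (n j : ℕ), j ≤ n → κ ≤ w * j → ∀ x : ℝ,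
        (Measure.pi fun _ : Fin n => ρB) {b | vaN w x (finExt b) S.ξ j < 2 * ν * j} ≤
          ENNReal.ofReal (Real.exp (-(c * j))) := by
  set pt : ℝ := ∫ b', S.ξ b' * τ b' with hpt
  have hpt0 : 0 < pt := S.mass_pos
  obtain ⟨w₁, hw₁, η, hη0, -, hsweep⟩ :=
    ahPhase_far_int_card_ge bm bp hτ.lo hτ.bm_nonpos hτ.bp_nonneg hκ
  refine ⟨w₁, hw₁, pt * η ^ 2, by positivity, 2 * pt ^ 2 * η ^ 4, by positivity, ?_⟩
  intro w hw n j hjn hκj x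
  set μ := (Measure.pi fun _ : Fin n => ρB) with hμ
  set lam : ℝ := 2 * pt * η ^ 2 with hlam
  have hlam0 : 0 < lam := by positivity
  -- the time-dependent summands of `-λ M`
  set hl : ℕ → ℝ → ℝ → ℝ := fun l y b =>
    if l < j then -lam * (S.ξ b - pt) * (1 - Real.cos (2 * π * y)) else 0 with hhl
  have hhm : ∀ l, Measurable (Function.uncurry (hl l)) := by
    intro l
    by_cases hlj : l < j
    · simp only [hhl, hlj, ↓reduceIte]
      exact ((measurable_const.mul ((S.ξ_measurable.comp measurable_snd).sub measurable_const)).mul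
        (measurable_const.sub (Real.measurable_cos.comp (measurable_const.mul measurable_fst))))
    · simp only [hhl, hlj, ↓reduceIte]
      exact measurable_const
  set θ : ℕ → ℝ≥0∞ := fun l => if l < j then ENNReal.ofReal (Real.exp (lam ^ 2 / 2)) else 1 with hθ
  have hstep : ∀ l y, ∫⁻ b, ENNReal.ofReal (Real.exp (hl l y b)) ∂ρB ≤ θ l := by
    intro l y
    by_cases hlj : l < j
    · simp only [hhl, hθ, hlj, ↓reduceIte]
      set t : ℝ := -lam * (1 - Real.cos (2 * π * y)) with ht
      have ht2 : t ^ 2 ≤ 4 * lam ^ 2 := by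
        have h1 : 0 ≤ 1 - Real.cos (2 * π * y) := by linarith [Real.cos_le_one (2 * π * y)]
        have h2 : 1 - Real.cos (2 * π * y) ≤ 2 := by linarith [Real.neg_one_le_cos (2 * π * y)]
        rw [ht, show (-lam * (1 - Real.cos (2 * π * y))) ^ 2 = lam ^ 2 * (1 - Real.cos (2 * π * y)) ^ 2 by ring]
        have h3 : (1 - Real.cos (2 * π * y)) ^ 2 ≤ 4 := by nlinarith
        nlinarith [sq_nonneg lam]
      have hfun : (fun b => ENNReal.ofReal (Real.exp (-lam * (S.ξ b - pt) * (1 - Real.cos (2 * π * y))))) =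
          fun b => ENNReal.ofReal (Real.exp (t * (S.ξ b - ∫ b', S.ξ b' * τ b'))) := by
        funext b; rw [ht, hpt]; ring_nf
      rw [hfun]
      refine (lintegral_exp_mul_centredBump_le hτ S hρ t).trans (ENNReal.ofReal_le_ofReal ?_)
      exact Real.exp_le_exp.mpr (by nlinarith)
    · simp only [hhl, hθ, hlj, ↓reduceIte, Real.exp_zero, ENNReal.ofReal_one, lintegral_const,
        measure_univ, mul_one, le_refl]
  have hpeel := lintegral_exp_sumT_le w ρB n hl θ hhm hstep x
  have hprod : ∏ l ∈ Finset.range n, θ l = ENNReal.ofReal (Real.exp (j * (lam ^ 2 / 2))) := by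
    rw [Finset.prod_ite, Finset.prod_const_one, mul_one, Finset.prod_const]
    have hf : ((Finset.range n).filter fun l => l < j) = Finset.range j := by
      ext l; simp only [Finset.mem_filter, Finset.mem_range]; omega
    rw [hf, Finset.card_range, ← ENNReal.ofReal_pow (Real.exp_pos _).le, ← Real.exp_nat_mul]
  rw [hprod] at hpeel
  -- the functional `-λ M` and its relation to `N_j`
  set F : (Fin n → ℝ) → ℝ := fun b => ∑ l ∈ Finset.range n, hl l (ahPhase w x (finExt b) l) (finExt b l)
    with hF
  have hFm : Measurable F := measurable_sumT w hhm x n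
  have hFeq : ∀ b : Fin n → ℝ, F b = -lam * (vaN w x (finExt b) S.ξ j -
      pt * ∑ k ∈ Finset.range j, vaU w x (finExt b) k) := by
    intro b
    rw [hF]
    simp only [hhl]
    rw [← Finset.sum_filter]
    have hf : ((Finset.range n).filter fun l => l < j) = Finset.range j := by
      ext l; simp only [Finset.mem_filter, Finset.mem_range]; omega
    rw [hf]
    unfold vaN vaU
    rw [Finset.mul_sum, mul_sub, Finset.mul_sum, Finset.mul_sum, ← Finset.sum_sub_distrib]
    exact Finset.sum_congr rfl fun k _ => by ring
  -- on the cube, the bad event forces `-λM ≥ λ · 2p̃η²j`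
  have hcube : ∀ b : Fin n → ℝ, (∀ i, bm ≤ b i ∧ b i ≤ bp) →
      vaN w x (finExt b) S.ξ j < 2 * (pt * η ^ 2) * j → lam * (2 * pt * η ^ 2 * j) ≤ F b := by
    intro b hb hbad
    have hB : ∀ k, finExt b k ∈ Set.Icc bm bp := fun k => by
      by_cases hk : k < n
      · rw [finExt_of_lt _ hk]; exact ⟨(hb _).1, (hb _).2⟩
      · simp only [finExt, hk, ↓reduceDIte]; exact ⟨hτ.bm_nonpos, hτ.bp_nonneg⟩
    have hcard := hsweep w hw x (finExt b) hB 0 j (by simpa using hκj)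
    rw [zero_add] at hcard
    set G := (Finset.Ico 0 j).filter fun k => 4 * η ^ 2 ≤ Real.sin (π * ahPhase w x (finExt b) k) ^ 2
      with hG
    have hsumu : 4 * η ^ 2 * j ≤ ∑ k ∈ Finset.range j, vaU w x (finExt b) k := by
      have h1 : ∑ k ∈ G, (8 * η ^ 2) ≤ ∑ k ∈ G, vaU w x (finExt b) k := by
        refine Finset.sum_le_sum fun k hk => ?_
        rw [vaU_eq_sin_sq]
        have := (Finset.mem_filter.mp hk).2
        linarith
      have h2 : ∑ k ∈ G, vaU w x (finExt b) k ≤ ∑ k ∈ Finset.range j, vaU w x (finExt b) k := by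
        refine Finset.sum_le_sum_of_subset_of_nonneg ?_ fun k _ _ => (vaU_bounds w x _ k).1
        intro k hk
        have := (Finset.mem_Ico.mp (Finset.mem_filter.mp hk).1).2
        exact Finset.mem_range.mpr this
      rw [Finset.sum_const, nsmul_eq_mul] at h1
      have h3 : (j : ℝ) / 2 * (8 * η ^ 2) ≤ (G.card : ℝ) * (8 * η ^ 2) :=
        mul_le_mul_of_nonneg_right hcard (by positivity)
      linarith
    rw [hFeq]
    have : vaN w x (finExt b) S.ξ j - pt * ∑ k ∈ Finset.range j, vaU w x (finExt b) k ≤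
        -(2 * pt * η ^ 2 * j) := by
      have := mul_le_mul_of_nonneg_left hsumu hpt0.le
      linarith
    nlinarith
  -- Markov's inequality
  have hae : ∀ᵐ b ∂μ, ∀ i, bm ≤ b i ∧ b i ≤ bp := ae_pi_mem_Icc hτ.eq_zero hρ n
  set tt : ℝ := lam * (2 * pt * η ^ 2 * j) with htt
  have hsub : {b : Fin n → ℝ | vaN w x (finExt b) S.ξ j < 2 * (pt * η ^ 2) * j} ≤ᵐ[μ]
      {b | ENNReal.ofReal (Real.exp tt) ≤ ENNReal.ofReal (Real.exp (F b))} :=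
    hae.mono fun b hb hbad => ENNReal.ofReal_le_ofReal (Real.exp_le_exp.mpr (hcube b hb hbad))
  have hmk := mul_meas_ge_le_lintegral₀ (μ := μ)
    (f := fun b => ENNReal.ofReal (Real.exp (F b)))
    (ENNReal.measurable_ofReal.comp (Real.measurable_exp.comp hFm)).aemeasurable
    (ENNReal.ofReal (Real.exp tt))
  have hett : ENNReal.ofReal (Real.exp tt) ≠ 0 := (ENNReal.ofReal_pos.mpr (Real.exp_pos _)).ne'
  calc μ {b | vaN w x (finExt b) S.ξ j < 2 * (pt * η ^ 2) * j}
      ≤ μ {b | ENNReal.ofReal (Real.exp tt) ≤ ENNReal.ofReal (Real.exp (F b))} := measure_mono_ae hsub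
    _ ≤ (∫⁻ b, ENNReal.ofReal (Real.exp (F b)) ∂μ) / ENNReal.ofReal (Real.exp tt) := by
        rw [ENNReal.le_div_iff_mul_le (Or.inl hett) (Or.inl ENNReal.ofReal_ne_top), mul_comm]
        exact hmk
    _ ≤ ENNReal.ofReal (Real.exp (j * (lam ^ 2 / 2))) / ENNReal.ofReal (Real.exp tt) :=
        ENNReal.div_le_div_right hpeel _
    _ = ENNReal.ofReal (Real.exp (j * (lam ^ 2 / 2)) / Real.exp tt) :=
        (ENNReal.ofReal_div_of_pos (Real.exp_pos _)).symm
    _ = ENNReal.ofReal (Real.exp (-(2 * pt ^ 2 * η ^ 4 * j))) := by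
        rw [← Real.exp_sub]
        congr 2
        rw [htt, hlam]; ring

end GoodSum

/-! ### Integrability plumbing on the disorder space -/

section Integrability

/-- The reduced masses lie in the closed cube almost surely. [folklore] -/
theorem ae_pi_cube (hτ : ReducedLawHyp τ bm bp) {ρB : Measure ℝ} [IsProbabilityMeasure ρB]
    (hρ : ρB = volume.withDensity fun s => ENNReal.ofReal (τ s)) (n : ℕ) :
    ∀ᵐ b ∂(Measure.pi fun _ : Fin n => ρB), ∀ i, bm ≤ b i ∧ b i ≤ bp :=
  ae_pi_mem_Icc hτ.eq_zero hρ n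

/-- The closed cube lies in the open cube of half-width `b_* + 1`. [folklore] -/
theorem mem_openCube_of_mem_cube {n : ℕ} {b : Fin n → ℝ} (hb : ∀ i, bm ≤ b i ∧ b i ≤ bp) :
    b ∈ Set.pi Set.univ fun _ : Fin n => Set.Ioo (-(max |bm| |bp| + 1)) (max |bm| |bp| + 1) := by
  intro i _
  have h := ReducedLawHyp.abs_le_of_mem (bm := bm) (bp := bp) ⟨(hb i).1, (hb i).2⟩
  have := abs_le.mp h
  exact ⟨by linarith, by linarith⟩

/-- **A functional continuous on the open cube is a.e. bounded and integrable** (it is bounded on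
the compact closed cube, which carries the measure). [folklore] -/
theorem integrable_pi_of_continuousOn (hτ : ReducedLawHyp τ bm bp) {ρB : Measure ℝ}
    [IsProbabilityMeasure ρB] (hρ : ρB = volume.withDensity fun s => ENNReal.ofReal (τ s))
    {n : ℕ} {F : (Fin n → ℝ) → ℝ}
    (hF : ContinuousOn F (Set.pi Set.univ fun _ : Fin n => Set.Ioo (-(max |bm| |bp| + 1)) (max |bm| |bp| + 1))) :
    (∃ C, ∀ᵐ b ∂(Measure.pi fun _ : Fin n => ρB), |F b| ≤ C) ∧
      Integrable F (Measure.pi fun _ : Fin n => ρB) := by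
  set μ := (Measure.pi fun _ : Fin n => ρB) with hμ
  set U := (Set.pi Set.univ fun _ : Fin n => Set.Ioo (-(max |bm| |bp| + 1)) (max |bm| |bp| + 1)) with hU
  set K := (Set.pi Set.univ fun _ : Fin n => Set.Icc bm bp) with hK
  have hUo : IsOpen U := isOpen_set_pi Set.finite_univ fun _ _ => isOpen_Ioo
  have hKc : IsCompact K := isCompact_univ_pi fun _ => isCompact_Icc
  have hKU : K ⊆ U := fun b hb =>
    mem_openCube_of_mem_cube fun i => ⟨(hb i (Set.mem_univ _)).1, (hb i (Set.mem_univ _)).2⟩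
  have haeK : ∀ᵐ b ∂μ, b ∈ K := (ae_pi_cube hτ hρ n).mono fun b hb i _ => ⟨(hb i).1, (hb i).2⟩
  obtain ⟨C, hC⟩ := hKc.exists_bound_of_continuousOn (hF.mono hKU)
  have hbound : ∀ᵐ b ∂μ, |F b| ≤ C := haeK.mono fun b hb => by simpa [Real.norm_eq_abs] using hC b hb
  have hmeas : AEStronglyMeasurable F μ := by
    have hres : μ.restrict U = μ := Measure.restrict_eq_self_of_ae_mem (haeK.mono fun b hb => hKU hb)
    rw [← hres]
    exact hF.aestronglyMeasurable hUo.measurableSet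
  exact ⟨⟨C, hbound⟩, ⟨hmeas, HasFiniteIntegral.of_bounded (hbound.mono fun b hb => by
    rw [Real.norm_eq_abs]; exact hb)⟩⟩

/-- A function of one reduced mass is integrable on the product if it is integrable in one
variable: the special case `μ = fun _ => ρB` of Mathlib's `MeasureTheory.integrable_comp_eval`,
kept under its old name as a deprecated alias (dedup-00669); use `integrable_comp_eval`.
[folklore] -/
@[deprecated MeasureTheory.integrable_comp_eval (since := "2026-08-15")]
theorem integrable_eval_comp {ρB : Measure ℝ} [IsProbabilityMeasure ρB] {n : ℕ} (k : Fin n)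
    {g : ℝ → ℝ} (hg : Integrable g ρB) :
    Integrable (fun b : Fin n → ℝ => g (b k)) (Measure.pi fun _ : Fin n => ρB) :=
  integrable_comp_eval hg

/-- `∫ g(B_k) dτ^{⊗n} = ∫ g dρ_B`: the special case `μ = fun _ => ρB` of Mathlib's
`MeasureTheory.integral_comp_eval`, kept under its old name as a deprecated alias (dedup-00670);
use `integral_comp_eval`. [folklore] -/
@[deprecated MeasureTheory.integral_comp_eval (since := "2026-08-15")]
theorem integral_eval_comp {ρB : Measure ℝ} [IsProbabilityMeasure ρB] {n : ℕ} (k : Fin n)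
    {g : ℝ → ℝ} (hg : AEStronglyMeasurable g ρB) :
    ∫ b : Fin n → ℝ, g (b k) ∂(Measure.pi fun _ : Fin n => ρB) = ∫ t, g t ∂ρB :=
  integral_comp_eval hg

/-- Integrability against `ρ_B` from integrability against `τ db`. [folklore] -/
theorem integrable_rhoB_of_integrable_mul (hτ : ReducedLawHyp τ bm bp) {ρB : Measure ℝ}
    (hρ : ρB = volume.withDensity fun s => ENNReal.ofReal (τ s)) {g : ℝ → ℝ}
    (hg : Integrable (fun t => g t * τ t)) : Integrable g ρB := by
  rw [hρ, integrable_withDensity_iff hτ.measurable.ennreal_ofReal (ae_of_all _ fun _ => ENNReal.ofReal_lt_top)]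
  refine (hg.congr (ae_of_all _ fun t => ?_))
  show g t * τ t = g t * (ENNReal.ofReal (τ t)).toReal
  rw [ENNReal.toReal_ofReal (hτ.nonneg t)]

/-- `ℓ²` and `ℓ` are `ρ_B`-integrable. [folklore] -/
theorem integrable_ell_sq (hτ : ReducedLawHyp τ bm bp) (S : SmoothingField τ bm bp) {ρB : Measure ℝ}
    [IsProbabilityMeasure ρB] (hρ : ρB = volume.withDensity fun s => ENNReal.ofReal (τ s)) :
    Integrable (fun t => S.ℓ t ^ 2) ρB ∧ Integrable S.ℓ ρB := by
  obtain ⟨C, hint, -⟩ := S.ℓ_sq_bound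
  have h2 : Integrable (fun t => S.ℓ t ^ 2) ρB :=
    integrable_rhoB_of_integrable_mul hτ hρ hint
  refine ⟨h2, ?_⟩
  have h1 : Integrable (fun t => 1 + S.ℓ t ^ 2) ρB := (integrable_const 1).add h2
  refine h1.mono' S.ℓ_measurable.aestronglyMeasurable (ae_of_all _ fun t => ?_)
  rw [Real.norm_eq_abs]
  nlinarith [abs_nonneg (S.ℓ t), sq_abs (S.ℓ t)]

/-- `∫ ℓ dρ_B = 0` and `∫ ℓ² dρ_B ≤ C_ℓ`. [folklore] -/
theorem integral_ell_rhoB (hτ : ReducedLawHyp τ bm bp) (S : SmoothingField τ bm bp) {ρB : Measure ℝ}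
    [IsProbabilityMeasure ρB] (hρ : ρB = volume.withDensity fun s => ENNReal.ofReal (τ s)) :
    ∫ t, S.ℓ t ∂ρB = 0 ∧ ∃ C, ∫ t, S.ℓ t ^ 2 ∂ρB ≤ C := by
  refine ⟨by rw [integral_rhoB hτ hρ]; exact S.ℓ_mean_zero, ?_⟩
  obtain ⟨C, -, hC⟩ := S.ℓ_sq_bound
  exact ⟨C, by rw [integral_rhoB hτ hρ]; exact hC⟩

/-- Product of an a.e.-bounded a.e.-strongly measurable functional with an integrable one is
integrable: Mathlib's `MeasureTheory.Integrable.bdd_mul` with the arguments permuted (`|F b|` is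
`‖F b‖` by `rfl`), kept under its old name as a deprecated alias (dedup-00671); use
`hG.bdd_mul hFm hFb`. [folklore] -/
@[deprecated MeasureTheory.Integrable.bdd_mul (since := "2026-08-15")]
theorem integrable_bdd_mul' {α : Type*} [MeasurableSpace α] {μ : Measure α}
    {F G : α → ℝ} (hFm : AEStronglyMeasurable F μ) {C : ℝ} (hFb : ∀ᵐ b ∂μ, |F b| ≤ C)
    (hG : Integrable G μ) : Integrable (fun b => F b * G b) μ :=
  hG.bdd_mul hFm hFb

/-- `ℓ(B_k) ℓ(B_l)` is integrable on the product space. [folklore] -/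
theorem integrable_ell_mul_ell (hτ : ReducedLawHyp τ bm bp) (S : SmoothingField τ bm bp) {ρB : Measure ℝ}
    [IsProbabilityMeasure ρB] (hρ : ρB = volume.withDensity fun s => ENNReal.ofReal (τ s)) {n : ℕ}
    (k l : Fin n) :
    Integrable (fun b : Fin n → ℝ => S.ℓ (b k) * S.ℓ (b l)) (Measure.pi fun _ : Fin n => ρB) := by
  obtain ⟨h2, -⟩ := integrable_ell_sq hτ S hρ
  have hk := integrable_comp_eval (μ := fun _ : Fin n => ρB) (i := k) (f := fun t => S.ℓ t ^ 2) h2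
  have hl := integrable_comp_eval (μ := fun _ : Fin n => ρB) (i := l) (f := fun t => S.ℓ t ^ 2) h2
  have hsum : Integrable (fun b : Fin n → ℝ => (S.ℓ (b k) ^ 2 + S.ℓ (b l) ^ 2) / 2)
      (Measure.pi fun _ : Fin n => ρB) := (hk.add hl).div_const 2
  refine hsum.mono' ?_ (ae_of_all _ fun b => ?_)
  · exact ((S.ℓ_measurable.comp (measurable_pi_apply k)).mul
      (S.ℓ_measurable.comp (measurable_pi_apply l))).aestronglyMeasurable
  · rw [Real.norm_eq_abs, abs_mul]
    nlinarith [sq_nonneg (|S.ℓ (b k)| - |S.ℓ (b l)|), sq_abs (S.ℓ (b k)), sq_abs (S.ℓ (b l))]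

/-- A bounded measurable function of one reduced mass times an integrable functional is
integrable; in particular `B_k · G`, `ξ(B_k) · G`. [folklore] -/
theorem integrable_coord_fun_mul {ρB : Measure ℝ} [IsProbabilityMeasure ρB] {n : ℕ} (k : Fin n)
    {g : ℝ → ℝ} (hgm : Measurable g) {C : ℝ} (hgb : ∀ᵐ t ∂ρB, |g t| ≤ C)
    {G : (Fin n → ℝ) → ℝ} (hG : Integrable G (Measure.pi fun _ : Fin n => ρB)) :
    Integrable (fun b : Fin n → ℝ => g (b k) * G b) (Measure.pi fun _ : Fin n => ρB) := by
  refine hG.bdd_mul (hgm.comp (measurable_pi_apply k)).aestronglyMeasurable (c := C) ?_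
  have hmp := measurePreserving_eval (fun _ : Fin n => ρB) k
  have := hmp.quasiMeasurePreserving.ae hgb
  exact this

end Integrability

end Literature.Barriers.AtomisticToContinuum.HeatConduction

end
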